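import Summits.CriticalPhenomena.PercolationContinuityZ3.Theorems.PercNearOneGluingNoHeavyQuantCatHullLeafCheck
import HarnessLib

/-!
# QUANT lane R8, T-DEC: RUNNING THE LEAF CHECK OVER A TABLE — kd-trees per `G`-strip, and the strip-free statement of soundness

builds on p205010 (kernel theorem, internal audit signed; external expert review pending)

Support file (`--supports stmt-CriticalPhenomena-4575`), QUANT lane census seat prim-quant-census-2 (gen 78).  Definitions + theorems; standard axioms,
no sorries.  `Tab.leafOK sh … y T trees` replays one kd-tree per `G`-strip of `T` (root box = strip × `[0,1]³`) against `Tab.leafBoxOK`;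
`Tab.leafOK_sound`: for every reach `G` in the table's range and all parameters `t ∈ [0,1]³` (with the absolute mean inside the table),
`G · lhsG(y/G, t) ≤ T.Z G (G · rate(y/G, t))`.  With `…QuantCatHullTinySupport` (which pins a tiny-support caterpillar law to such parameters) this is
the `leaf` field of `CatValueBoundS` for one leaf shape.  [this work].  Nothing here is cited as a published result.  The gluing rows served
[cite: KozmaNitzan2024, Conjecture 3 (p. 15)]; product measure [cite: Grimmett1999, §1.3 p. 10].
-/

noncomputable section

namespace Summit.CriticalPhenomena.PercolationContinuityZ3.Theorems
namespace Quant
namespace LawDec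
namespace Tab

/-- the root box of `G`-strip `k`: the strip times the unit parameter cube. [this work] -/
def rootBox (T : Tab) (k : ℕ) : Box := ⟨T.gb.getD k 0, T.gb.getD (k + 1) 0, fun _ => 0, fun _ => 1⟩

/-- **the leaf check for one shape over a whole table**: one kd-tree per `G`-strip. [this work] -/
def leafOK (sh : Shape) (Pu P0 P1 P2 Q0 Q1 Q2 : ℚ) (y : ℚ) (T : Tab) (trees : List KD) : Bool :=
  (List.range (T.gb.length - 1)).all fun k => KD.run (leafBoxOK sh Pu P0 P1 P2 Q0 Q1 Q2 y T k) (trees.getD k KD.leaf) (T.rootBox k)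

/-- **SOUNDNESS OF THE LEAF CHECK OVER A TABLE.** [this work] -/
theorem leafOK_sound {sh : Shape} {Pu P0 P1 P2 Q0 Q1 Q2 y : ℚ} {T : Tab} {trees : List KD}
    (h : leafOK sh Pu P0 P1 P2 Q0 Q1 Q2 y T trees = true) (hw : T.wf = true)
    {G : ℝ} (hG : 0 < G) (hg0 : ((T.gb.getD 0 0 : ℚ) : ℝ) ≤ G) (hg1 : G ≤ ((T.gb.getLast?.getD 0 : ℚ) : ℝ))
    {t : Fin 3 → ℝ} (ht : ∀ i, 0 ≤ t i ∧ t i ≤ 1)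
    (hA1 : G * sh.rate ((y : ℝ) / G) (t 0) (t 1) (t 2) ≤ ((T.ab.getLast?.getD 0 : ℚ) : ℝ)) :
    G * sh.lhsG (Pu : ℝ) P0 P1 P2 Q0 Q1 Q2 ((y : ℝ) / G) (t 0) (t 1) (t 2) ≤ T.Z G (G * sh.rate ((y : ℝ) / G) (t 0) (t 1) (t 2)) := by
  have hw' := hw
  unfold wf at hw'; simp only [Bool.and_eq_true, decide_eq_true_eq] at hw'
  obtain ⟨⟨⟨⟨⟨hlen, _⟩, _⟩, _⟩, _⟩, _⟩ := hw'
  set k := idx T.gb G with hk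
  have hk2 : k + 2 ≤ T.gb.length := idx_lt _ _ hlen
  unfold leafOK at h; rw [List.all_eq_true] at h
  have hrun := h k (List.mem_range.2 (by omega))
  have hmem : (T.rootBox k).mem G t := by
    refine ⟨getD_idx_le _ _ hg0, ?_, fun i => ?_⟩
    · show G ≤ ((T.gb.getD (k + 1) 0 : ℚ) : ℝ)
      have e : T.gb.getD (k + 1) 0 = T.gb.getD (k + 1) 0 := rfl
      have := le_getD_idx_succ T.gb G hlen hg1
      have e1 : T.gb.getD (idx T.gb G + 1) 0 = T.gb.getD (k + 1) 0 := by rw [hk]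
      rwa [e1] at this
    · show ((0 : ℚ) : ℝ) ≤ t i ∧ t i ≤ ((1 : ℚ) : ℝ)
      push_cast; exact ht i
  exact KD.run_sound (P := fun G' t' => 0 < G' → G' * sh.rate ((y : ℝ) / G') (t' 0) (t' 1) (t' 2) ≤ ((T.ab.getLast?.getD 0 : ℚ) : ℝ) →
      G' * sh.lhsG (Pu : ℝ) P0 P1 P2 Q0 Q1 Q2 ((y : ℝ) / G') (t' 0) (t' 1) (t' 2) ≤ T.Z G' (G' * sh.rate ((y : ℝ) / G') (t' 0) (t' 1) (t' 2)))
    (fun B hB G' t' hm hG' hA' => leafBox_sound sh Pu P0 P1 P2 Q0 Q1 Q2 hw hk2 hB hm hG' hA') _ _ hrun G t hmem hG hA1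

end Tab
end LawDec
end Quant
end Summit.CriticalPhenomena.PercolationContinuityZ3.Theorems
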